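import Mathlib
import Literature.Probability.LatticeModels.HighDimPointwiseTriviality
import Summits.CriticalPhenomena.Ising3DConformalLimit.Theorems.EnergyNotSigmaSquaredMoebiusLimitExistsMoveIneq
import Summits.CriticalPhenomena.Ising3DConformalLimit.Theorems.PerfectScreeningMixedSpectralRepresentation

/-!
# Crux `CriticalTwoPointGSM`, line `Sketch` (canonical-lift spine): the Cesàro identity

Route `GaussianScaleMixture` of `Ising3DConformalLimit`, crux `CriticalTwoPointGSM`
(stmt-CriticalPhenomena-8365), line `Sketch`, canonical-lift spine (seat c1), stub
`js_cesaroIdentity`.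

The joint spectral measure of the critical two-point function `G` of the nearest-neighbour Ising
model on `ℤ³` is built from finite-`N` approximants indexed by the `(2N)²` discrete transverse
momenta `k_j = πj/N`, `j ∈ (-N, N]²`. This file is the finite-sum bookkeeping of that
construction: GIVEN the character orthogonality on `(ℤ/2Nℤ)²`
(`∑_{j ∈ (-N,N]²} cos(k_j·u) = (2N)²·[2N ∣ u]`, the statement of the sibling stub `js_trigSum`,
taken here as the hypothesis `htrig`), for `N ≥ 1`, `n ∈ ℤ` and `z ∈ ℤ²` with `|zᵢ| < N`,

`∑_j cos(k_j·z) ∑_{x,y ∈ [0,N)²} (cos(k_j·x) cos(k_j·y) + sin(k_j·x) sin(k_j·y)) G(n, x - y)`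
`= (2N)² · #{(x,y) ∈ [0,N)² × [0,N)² : x - y = z} · G(n, z)`.

Proof: `cos a cos b + sin a sin b = cos(a - b)` and the phase is linear, so the inner summand is
`cos(k_j·(x-y)) G(n,x-y)`; swap the sums; `2 cos A cos B = cos(A - B) + cos(A + B)` and
orthogonality at `u = z ∓ (x - y)`; since `|zᵢ ∓ (xᵢ - yᵢ)| < 2N`, divisibility by `2N` forces
`u = 0`, i.e. `x - y = ±z`; the `-z` count equals the `z` count by the swap `(x,y) ↦ (y,x)`, and
`G(n,-z) = G(n,z)` (evenness of `G` and the sign change of the axial coordinate).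

Contents: helpers in `CriticalTwoPointGSMJs.JsCesaroIdentity`, written for an abstract phase
`θ j w` that is additive in the site `w` and an abstract momentum set `J` carrying the
orthogonality (product-to-sum/orthogonality `sum_cos_mul_cos`, the small-vector lemma
`forall_dvd_iff_eq_zero`, the evenness `criticalTwoPoint_cons_neg`, the swap count
`card_filter_sub_eq_neg`, the diagonal count `sum_sum_ite_mul`, and the abstract identity
`main`), then the registered stub `js_cesaroIdentity` (the phase `∑ᵢ π jᵢ wᵢ / N` is additive:
`phase_sub`). Nothing about measures is here; that is `js_approximants`.
-/

namespace Summit.CriticalPhenomena.Ising3DConformalLimit.Theorems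

open MeasureTheory Filter Topology
open Literature.Probability.LatticeModels
open scoped BigOperators

noncomputable section

namespace CriticalTwoPointGSMJs.JsCesaroIdentity

variable {N : ℕ} {J B : Finset (Fin 2 → ℤ)} {θ : (Fin 2 → ℤ) → (Fin 2 → ℤ) → ℝ}

/-! ## Product-to-sum and orthogonality for an additive phase -/

/-- A phase that is subtractive in the site is additive in the site. [folklore] -/
theorem phase_add_of_sub (hθ : ∀ j z w, θ j (z - w) = θ j z - θ j w) (j z w : Fin 2 → ℤ) :
    θ j (z + w) = θ j z + θ j w := by
  have h := hθ j (z + w) w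
  rw [add_sub_cancel_right] at h
  linarith

/-- **Product-to-sum + orthogonality.** For a subtractive phase `θ` and a momentum set `J` with
the character orthogonality at level `N` (`htrigN`), for `z, w ∈ ℤ²`:
`∑_{j ∈ J} cos(θ_j z) cos(θ_j w) = ((2N)²·[2N ∣ z - w] + (2N)²·[2N ∣ z + w]) / 2`. [folklore] -/
theorem sum_cos_mul_cos (hθ : ∀ j z w, θ j (z - w) = θ j z - θ j w)
    (htrigN : ∀ u : Fin 2 → ℤ, ∑ j ∈ J, Real.cos (θ j u) =
      if (∀ i : Fin 2, (2 * (N : ℤ)) ∣ u i) then (2 * (N : ℝ)) ^ 2 else 0)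
    (z w : Fin 2 → ℤ) :
    ∑ j ∈ J, Real.cos (θ j z) * Real.cos (θ j w) =
      ((if (∀ i : Fin 2, (2 * (N : ℤ)) ∣ (z - w) i) then (2 * (N : ℝ)) ^ 2 else 0) +
        (if (∀ i : Fin 2, (2 * (N : ℤ)) ∣ (z + w) i) then (2 * (N : ℝ)) ^ 2 else 0)) / 2 := by
  rw [← htrigN (z - w), ← htrigN (z + w), ← Finset.sum_add_distrib, eq_div_iff two_ne_zero,
    Finset.sum_mul]
  refine Finset.sum_congr rfl fun j _ => ?_
  rw [hθ, phase_add_of_sub hθ, Real.cos_sub, Real.cos_add]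
  ring

/-! ## Small vectors: divisibility by `2N` forces vanishing -/

/-- A vector `u ∈ ℤ²` with `|uᵢ| < 2N` is divisible by `2N` coordinatewise iff `u = 0`.
[folklore] -/
theorem forall_dvd_iff_eq_zero (u : Fin 2 → ℤ) (hu : ∀ i, |u i| < 2 * (N : ℤ)) :
    (∀ i : Fin 2, (2 * (N : ℤ)) ∣ u i) ↔ u = 0 := by
  constructor
  · intro h
    funext i
    exact Int.eq_zero_of_abs_lt_dvd (h i) (hu i)
  · rintro rfl i
    exact dvd_zero _

/-- For `x, y` in a set `B ⊆ [0,N)²` and `|zᵢ| < N`: `2N ∣ z - (x - y)` coordinatewise iff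
`x - y = z`. [folklore] -/
theorem dvd_sub_iff (hB : ∀ x ∈ B, ∀ i : Fin 2, 0 ≤ x i ∧ x i < N) {x y z : Fin 2 → ℤ}
    (hx : x ∈ B) (hy : y ∈ B) (hz : ∀ i : Fin 2, |z i| < N) :
    (∀ i : Fin 2, (2 * (N : ℤ)) ∣ (z - (x - y)) i) ↔ x - y = z := by
  rw [forall_dvd_iff_eq_zero (z - (x - y)) ?_, sub_eq_zero, eq_comm]
  intro i
  have h1 := hB x hx i
  have h2 := hB y hy i
  have h3 := abs_lt.1 (hz i)
  rw [abs_lt, Pi.sub_apply, Pi.sub_apply]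
  omega

/-- For `x, y` in a set `B ⊆ [0,N)²` and `|zᵢ| < N`: `2N ∣ z + (x - y)` coordinatewise iff
`x - y = -z`. [folklore] -/
theorem dvd_add_iff (hB : ∀ x ∈ B, ∀ i : Fin 2, 0 ≤ x i ∧ x i < N) {x y z : Fin 2 → ℤ}
    (hx : x ∈ B) (hy : y ∈ B) (hz : ∀ i : Fin 2, |z i| < N) :
    (∀ i : Fin 2, (2 * (N : ℤ)) ∣ (z + (x - y)) i) ↔ x - y = -z := by
  rw [forall_dvd_iff_eq_zero (z + (x - y)) ?_, add_eq_zero_iff_eq_neg']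
  intro i
  have h1 := hB x hx i
  have h2 := hB y hy i
  have h3 := abs_lt.1 (hz i)
  rw [abs_lt, Pi.add_apply, Pi.sub_apply]
  omega

/-- **The momentum sum at a pair `(x, y)` of the box.** For `x, y ∈ B ⊆ [0,N)²`, `|zᵢ| < N` and
any weight `g`: `∑_j cos(θ_j z) cos(θ_j (x-y)) g = ½ [x - y = z] (2N)² g + ½ [x - y = -z] (2N)² g`.
[folklore] -/
theorem sum_momenta_pair (hθ : ∀ j z w, θ j (z - w) = θ j z - θ j w)
    (htrigN : ∀ u : Fin 2 → ℤ, ∑ j ∈ J, Real.cos (θ j u) =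
      if (∀ i : Fin 2, (2 * (N : ℤ)) ∣ u i) then (2 * (N : ℝ)) ^ 2 else 0)
    (hB : ∀ x ∈ B, ∀ i : Fin 2, 0 ≤ x i ∧ x i < N)
    {x y z : Fin 2 → ℤ} (hx : x ∈ B) (hy : y ∈ B) (hz : ∀ i : Fin 2, |z i| < N) (g : ℝ) :
    ∑ j ∈ J, Real.cos (θ j z) * Real.cos (θ j (x - y)) * g =
      2⁻¹ * ((if x - y = z then (2 * (N : ℝ)) ^ 2 else 0) * g) +
        2⁻¹ * ((if x - y = -z then (2 * (N : ℝ)) ^ 2 else 0) * g) := by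
  rw [← Finset.sum_mul, sum_cos_mul_cos hθ htrigN z (x - y),
    if_congr (dvd_sub_iff hB hx hy hz) rfl rfl, if_congr (dvd_add_iff hB hx hy hz) rfl rfl]
  ring

/-! ## Evenness and counting -/

/-- **Evenness in the transverse variable:** `G(n, -z) = G(n, z)` — from `G(-v) = G(v)`
(`(n, -z) ↦ (-n, z)`) and the sign change of the axial coordinate. [folklore] -/
theorem criticalTwoPoint_cons_neg (n : ℤ) (z : Fin 2 → ℤ) :
    criticalTwoPoint 3 (Fin.cons n (-z) : Site 3) = criticalTwoPoint 3 (Fin.cons n z) := by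
  have h : (Fin.cons n (-z) : Site 3) =
      Function.update (Fin.cons (-n) (-z) : Site 3) 0 (-(Fin.cons (-n) (-z) : Site 3) 0) := by
    funext k
    refine Fin.cases ?_ (fun k => ?_) k
    · simp
    · simp
  rw [h, MoebiusLimitExistsOnlyInteraction.criticalTwoPoint_update_neg, ← MixedSpectral.neg_cons,
    criticalTwoPoint_neg]

/-- **Swap symmetry of the pair count:** `#{(x,y) ∈ B × B : x - y = -z} = #{(x,y) : x - y = z}`
by `(x, y) ↦ (y, x)`. [folklore] -/
theorem card_filter_sub_eq_neg (B : Finset (Fin 2 → ℤ)) (z : Fin 2 → ℤ) :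
    ((B ×ˢ B).filter (fun xy => xy.1 - xy.2 = -z)).card =
      ((B ×ˢ B).filter (fun xy => xy.1 - xy.2 = z)).card := by
  refine Finset.card_equiv (Equiv.prodComm _ _) (fun xy => ?_)
  simp only [Finset.mem_filter, Finset.mem_product, Equiv.prodComm_apply, Prod.fst_swap,
    Prod.snd_swap]
  constructor
  · rintro ⟨⟨h1, h2⟩, h3⟩
    exact ⟨⟨h2, h1⟩, by rw [← neg_sub, h3, neg_neg]⟩
  · rintro ⟨⟨h1, h2⟩, h3⟩
    exact ⟨⟨h2, h1⟩, by rw [← neg_sub, h3]⟩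

/-- **Diagonal count:**
`∑_{x,y ∈ B} [x - y = z'] c G(n, x - y) = c · #{(x,y) : x - y = z'} · G(n, z')`. [folklore] -/
theorem sum_sum_ite_mul (B : Finset (Fin 2 → ℤ)) (n : ℤ) (z' : Fin 2 → ℤ) (c : ℝ) :
    ∑ x ∈ B, ∑ y ∈ B, (if x - y = z' then c else 0) * criticalTwoPoint 3 (Fin.cons n (x - y)) =
      c * (((B ×ˢ B).filter (fun xy => xy.1 - xy.2 = z')).card : ℝ) *
        criticalTwoPoint 3 (Fin.cons n z') := by
  rw [← Finset.sum_product']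
  have h : ∀ xy ∈ B ×ˢ B,
      (if xy.1 - xy.2 = z' then c else 0) * criticalTwoPoint 3 (Fin.cons n (xy.1 - xy.2)) =
        if xy.1 - xy.2 = z' then c * criticalTwoPoint 3 (Fin.cons n z') else 0 := by
    intro xy _
    split_ifs with hxy
    · rw [hxy]
    · rw [zero_mul]
  rw [Finset.sum_congr rfl h, ← Finset.sum_filter, Finset.sum_const, nsmul_eq_mul]
  ring

/-! ## The collapsed identity, abstract form -/

/-- **The Cesàro identity, abstract form.** For a subtractive phase `θ`, a momentum set `J` with
orthogonality at level `N`, a set `B ⊆ [0,N)²`, `n ∈ ℤ` and `|zᵢ| < N`: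
`∑_{j ∈ J} cos(θ_j z) ∑_{x,y ∈ B} (cos(θ_j x)cos(θ_j y) + sin(θ_j x)sin(θ_j y)) G(n,x-y)
 = (2N)² · #{(x,y) ∈ B × B : x - y = z} · G(n, z)`. [folklore] -/
theorem main (hθ : ∀ j z w, θ j (z - w) = θ j z - θ j w)
    (htrigN : ∀ u : Fin 2 → ℤ, ∑ j ∈ J, Real.cos (θ j u) =
      if (∀ i : Fin 2, (2 * (N : ℤ)) ∣ u i) then (2 * (N : ℝ)) ^ 2 else 0)
    (hB : ∀ x ∈ B, ∀ i : Fin 2, 0 ≤ x i ∧ x i < N)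
    (n : ℤ) {z : Fin 2 → ℤ} (hz : ∀ i : Fin 2, |z i| < N) :
    ∑ j ∈ J, Real.cos (θ j z) *
        ∑ x ∈ B, ∑ y ∈ B,
          (Real.cos (θ j x) * Real.cos (θ j y) + Real.sin (θ j x) * Real.sin (θ j y)) *
          criticalTwoPoint 3 (Fin.cons n (x - y)) =
      (2 * (N : ℝ)) ^ 2 * (((B ×ˢ B).filter (fun xy => xy.1 - xy.2 = z)).card : ℝ) *
        criticalTwoPoint 3 (Fin.cons n z) := by
  -- Step 1: `cos a cos b + sin a sin b = cos (a - b)`, linearity of the phase, constants inside.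
  have h1 : ∀ j ∈ J, Real.cos (θ j z) *
      ∑ x ∈ B, ∑ y ∈ B,
        (Real.cos (θ j x) * Real.cos (θ j y) + Real.sin (θ j x) * Real.sin (θ j y)) *
        criticalTwoPoint 3 (Fin.cons n (x - y)) =
      ∑ x ∈ B, ∑ y ∈ B, Real.cos (θ j z) * Real.cos (θ j (x - y)) *
        criticalTwoPoint 3 (Fin.cons n (x - y)) := by
    intro j _
    rw [Finset.mul_sum]
    refine Finset.sum_congr rfl fun x _ => ?_
    rw [Finset.mul_sum]
    refine Finset.sum_congr rfl fun y _ => ?_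
    rw [← Real.cos_sub, ← hθ]
    ring
  rw [Finset.sum_congr rfl h1, Finset.sum_comm]
  -- Step 2: swap the momentum sum inside and collapse it at each pair `(x, y)`.
  have h2 : ∀ x ∈ B, ∑ j ∈ J, ∑ y ∈ B,
      Real.cos (θ j z) * Real.cos (θ j (x - y)) * criticalTwoPoint 3 (Fin.cons n (x - y)) =
      ∑ y ∈ B,
        (2⁻¹ * ((if x - y = z then (2 * (N : ℝ)) ^ 2 else 0) *
            criticalTwoPoint 3 (Fin.cons n (x - y))) +
          2⁻¹ * ((if x - y = -z then (2 * (N : ℝ)) ^ 2 else 0) *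
            criticalTwoPoint 3 (Fin.cons n (x - y)))) := by
    intro x hx
    rw [Finset.sum_comm]
    exact Finset.sum_congr rfl fun y hy => sum_momenta_pair hθ htrigN hB hx hy hz _
  rw [Finset.sum_congr rfl h2]
  -- Step 3: the two diagonal counts, the swap symmetry and the evenness.
  simp only [Finset.sum_add_distrib, ← Finset.mul_sum]
  rw [sum_sum_ite_mul, sum_sum_ite_mul, card_filter_sub_eq_neg, criticalTwoPoint_cons_neg]
  ring

/-! ## The concrete phase and box -/

/-- The concrete phase `k_j·w = ∑ᵢ π jᵢ wᵢ / N` is subtractive in the site `w`. [folklore] -/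
theorem phase_sub (N : ℕ) (j z w : Fin 2 → ℤ) :
    ∑ i : Fin 2, Real.pi * (j i : ℝ) * ((z - w) i : ℝ) / N =
      (∑ i : Fin 2, Real.pi * (j i : ℝ) * (z i : ℝ) / N) -
        ∑ i : Fin 2, Real.pi * (j i : ℝ) * (w i : ℝ) / N := by
  simp only [Pi.sub_apply, Int.cast_sub, ← Finset.sum_sub_distrib]
  refine Finset.sum_congr rfl fun i _ => ?_
  ring

/-- Points of the box `[0, N)²` have coordinates in `[0, N)`. [folklore] -/
theorem mem_box {N : ℕ} {x : Fin 2 → ℤ}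
    (hx : x ∈ Fintype.piFinset (fun _ : Fin 2 => Finset.Ico (0 : ℤ) N)) (i : Fin 2) :
    0 ≤ x i ∧ x i < N :=
  Finset.mem_Ico.1 (Fintype.mem_piFinset.1 hx i)

end CriticalTwoPointGSMJs.JsCesaroIdentity

/-- **STUB `js_cesaroIdentity` (finite-sum bookkeeping) of line `Sketch`, canonical-lift spine,
crux `CriticalTwoPointGSM`.** Given the character orthogonality `js_trigSum`
(`∑_{j ∈ (-N,N]²} cos(πj·u/N) = (2N)²·[2N ∣ u]`, hypothesis `htrig`): for `N ≥ 1`, `n ∈ ℤ` and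
`z ∈ ℤ²` with `|zᵢ| < N`, summing `cos(k_j·z)` against the quadratic forms of the coefficient
vectors `cos(k_j·x)`, `sin(k_j·x)` on the box `[0,N)²`, over the `(2N)²` momenta `k_j = πj/N`,
`j ∈ (-N,N]²`, collapses to `(2N)² · #{(x,y) ∈ [0,N)²×[0,N)² : x - y = z} · G(n,z)`
(by `cos a cos b + sin a sin b = cos(a-b)`, `2 cos a cos b = cos(a-b) + cos(a+b)`, orthogonality,
`|z ± (x-y)|_∞ < 2N`, the swap `(x,y) ↦ (y,x)` and the evenness `G(n,-z) = G(n,z)`).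
[folklore] -/
theorem js_cesaroIdentity
    (htrig : ∀ N : ℕ, 1 ≤ N → ∀ u : Fin 2 → ℤ,
      ∑ j ∈ Fintype.piFinset (fun _ : Fin 2 => Finset.Ioc (-(N : ℤ)) N),
          Real.cos (∑ i : Fin 2, Real.pi * (j i : ℝ) * (u i : ℝ) / N) =
        if (∀ i : Fin 2, (2 * (N : ℤ)) ∣ u i) then (2 * (N : ℝ)) ^ 2 else 0) :
    ∀ N : ℕ, 1 ≤ N → ∀ (n : ℤ) (z : Fin 2 → ℤ), (∀ i : Fin 2, |z i| < N) →
      ∑ j ∈ Fintype.piFinset (fun _ : Fin 2 => Finset.Ioc (-(N : ℤ)) N),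
        Real.cos (∑ i : Fin 2, Real.pi * (j i : ℝ) * (z i : ℝ) / N) *
          ∑ x ∈ Fintype.piFinset (fun _ : Fin 2 => Finset.Ico (0 : ℤ) N),
            ∑ y ∈ Fintype.piFinset (fun _ : Fin 2 => Finset.Ico (0 : ℤ) N),
              (Real.cos (∑ i : Fin 2, Real.pi * (j i : ℝ) * (x i : ℝ) / N) *
                  Real.cos (∑ i : Fin 2, Real.pi * (j i : ℝ) * (y i : ℝ) / N) +
                Real.sin (∑ i : Fin 2, Real.pi * (j i : ℝ) * (x i : ℝ) / N) *
                  Real.sin (∑ i : Fin 2, Real.pi * (j i : ℝ) * (y i : ℝ) / N)) *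
              criticalTwoPoint 3 (Fin.cons n (x - y)) =
      (2 * (N : ℝ)) ^ 2 *
        ((((Fintype.piFinset (fun _ : Fin 2 => Finset.Ico (0 : ℤ) N)) ×ˢ
            (Fintype.piFinset (fun _ : Fin 2 => Finset.Ico (0 : ℤ) N))).filter
            (fun xy => xy.1 - xy.2 = z)).card : ℝ) *
        criticalTwoPoint 3 (Fin.cons n z) := by
  intro N hN n z hz
  exact CriticalTwoPointGSMJs.JsCesaroIdentity.main
    (θ := fun j w => ∑ i : Fin 2, Real.pi * (j i : ℝ) * (w i : ℝ) / N)
    (CriticalTwoPointGSMJs.JsCesaroIdentity.phase_sub N) (fun u => htrig N hN u)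
    (fun x hx => CriticalTwoPointGSMJs.JsCesaroIdentity.mem_box hx) n hz

end

end Summit.CriticalPhenomena.Ising3DConformalLimit.Theorems
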